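import Mathlib.Analysis.Calculus.InverseFunctionTheorem.ContDiff
import Mathlib.Analysis.Calculus.ContDiff.Operations
import Mathlib.Analysis.Convex.PathConnected
import Mathlib.LinearAlgebra.FiniteDimensional.Lemmas
import Mathlib.Topology.Algebra.Module.FiniteDimension
import HarnessLib

/-!
# The thickening chart of a codimension-one immersion germ, and its two sides

Topic `Literature/Analysis/Calculus` (Euclidean core of the local two-sidedness of an embedded
surface in a `3`-manifold, used by the consumer-side π₁-obstruction for reducible trisections,
`Literature/Topology/FourManifolds/TwoSidedFromLocalSides.lean`).  **Everything here is
proved; no new facts.**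

* `Literature.Analysis.Calculus.exists_thickeningChart` — the **inverse function theorem for a
  thickened immersion germ**: if `f : P → V` is `C¹` at `p₀` with injective derivative `f'`
  and `n ∉ range f'`, where `dim P + 1 = dim V`, then `(p, a) ↦ f p + a • n` restricts to an
  `OpenPartialHomeomorph (P × ℝ) V` around `(p₀, 0)` (Hirsch 1976, Ch. 1, Thm. 3.1 (local
  form of immersions), here in the elementary "add a transverse line" form); the last
  coordinate of the inverse chart is a local defining function of the hypersurface germ
  `f(P)`, whose sign is the local side indicator.
* `Literature.Analysis.Calculus.isPreconnected_upperSide` /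
  `Literature.Analysis.Calculus.isPreconnected_lowerSide` — in the chart, when the ambient
  region is a curved half-space `{μ(p) + a ≥ 0}` (`|μ| < ε/2`, `μ > 0` exactly over an open
  half of the parameter domain — the picture of a compressing disc meeting the boundary of a
  handlebody along its boundary curve, after odd reflection), the two sides
  `{a > 0} ∩ {μ + a ≥ 0}` and `{a < 0} ∩ {μ + a ≥ 0}` of the product neighbourhood
  `B × (-ε, ε)` are preconnected ("core plus vertical segments").

## References

* M. W. Hirsch, *Differential Topology*, GTM 33, Springer (1976), Ch. 1 §3 and Ch. 4 §4.
  [HirschDT1976]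
-/

noncomputable section

open Set Function Filter Metric Module
open scoped Topology

namespace Literature.Analysis.Calculus

/-! ### A combinator for preconnectedness: a preconnected core reached from every point -/

/-- A set every point of which lies in a preconnected subset meeting a fixed preconnected
*core* `C ⊆ S` is preconnected. [folklore] -/
theorem isPreconnected_of_core {α : Type*} [TopologicalSpace α] {S C : Set α}
    (hC : IsPreconnected C) (hCS : C ⊆ S)
    (h : ∀ x ∈ S, ∃ t ⊆ S, x ∈ t ∧ (t ∩ C).Nonempty ∧ IsPreconnected t) : IsPreconnected S := by
  refine isPreconnected_of_forall_pair fun x hx y hy => ?_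
  obtain ⟨tx, htxS, hxtx, ⟨cx, hcx⟩, htx⟩ := h x hx
  obtain ⟨ty, htyS, hyty, ⟨cy, hcy⟩, hty⟩ := h y hy
  refine ⟨tx ∪ C ∪ ty, union_subset (union_subset htxS hCS) htyS,
    Or.inl (Or.inl hxtx), Or.inr hyty, ?_⟩
  exact (htx.union' ⟨cx, hcx⟩ hC).union' ⟨cy, Or.inr hcy.2, hcy.1⟩ hty

/-! ### The thickening chart -/

section Thickening

variable {P V : Type*} [NormedAddCommGroup P] [NormedSpace ℝ P]
  [NormedAddCommGroup V] [NormedSpace ℝ V]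

/-- The thickening `(p, a) ↦ f p + a • n` of a map differentiable at `p` is differentiable at
`(p, a)`, with derivative `(dp, da) ↦ f' dp + da • n`. [folklore] -/
theorem hasFDerivAt_thickening {f : P → V} {f' : P →L[ℝ] V} {p : P} (hf : HasFDerivAt f f' p)
    (n : V) (a : ℝ) :
    HasFDerivAt (fun q : P × ℝ => f q.1 + q.2 • n)
      (f'.comp (ContinuousLinearMap.fst ℝ P ℝ) + (ContinuousLinearMap.snd ℝ P ℝ).smulRight n)
      (p, a) := by
  have h1 : HasFDerivAt (fun q : P × ℝ => f q.1) (f'.comp (ContinuousLinearMap.fst ℝ P ℝ))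
      (p, a) := hf.comp (p, a) hasFDerivAt_fst
  have h2 : HasFDerivAt (fun q : P × ℝ => q.2 • n)
      ((ContinuousLinearMap.snd ℝ P ℝ).smulRight n) (p, a) := hasFDerivAt_snd.smul_const n
  exact h1.add h2

/-- If `f'` is injective and `n ∉ range f'`, the thickened derivative
`(dp, da) ↦ f' dp + da • n` is injective. [folklore] -/
theorem injective_thickeningDeriv {f' : P →L[ℝ] V} {n : V} (hf' : Injective f')
    (hn : n ∉ LinearMap.range (f' : P →ₗ[ℝ] V)) :
    Injective
      (f'.comp (ContinuousLinearMap.fst ℝ P ℝ) + (ContinuousLinearMap.snd ℝ P ℝ).smulRight n) := by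
  refine (injective_iff_map_eq_zero _).2 ?_
  rintro ⟨dp, da⟩ h
  have h' : f' dp + da • n = 0 := by simpa using h
  by_cases hda : da = 0
  · subst hda
    rw [zero_smul, add_zero] at h'
    have : dp = 0 := hf' (by rw [h', map_zero])
    simp [this]
  · exfalso
    refine hn ⟨-(da⁻¹ • dp), ?_⟩
    have : n = -(da⁻¹ • f' dp) := by
      have h2 : da • n = -f' dp := eq_neg_of_add_eq_zero_right h'
      calc n = da⁻¹ • (da • n) := by rw [smul_smul, inv_mul_cancel₀ hda, one_smul]
        _ = -(da⁻¹ • f' dp) := by rw [h2, smul_neg]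
    rw [this, map_neg, map_smul]
    rfl

/-- **The thickening chart of a codimension-one immersion germ (inverse function theorem).**
Let `f : P → V` be `C¹` at `p₀` between finite-dimensional real normed spaces with
`dim P + 1 = dim V`, with injective derivative `f'` at `p₀`, and let `n ∉ range f'`.  Then the
thickening `(p, a) ↦ f p + a • n` is a homeomorphism from a neighbourhood of `(p₀, 0)` onto an
open set: an `OpenPartialHomeomorph` with this underlying function and `(p₀, 0)` in its source.
(Hirsch 1976, Ch. 1, Thm. 3.1, local form of an immersion, via Mathlib's inverse function
theorem `ContDiffAt.toOpenPartialHomeomorph`.) [cite: HirschDT1976, Ch. 1, Thm. 3.1] -/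
theorem exists_thickeningChart [FiniteDimensional ℝ P] [FiniteDimensional ℝ V]
    {f : P → V} {f' : P →L[ℝ] V} {p₀ : P} {n : V} (hf : ContDiffAt ℝ 1 f p₀) (hf' : HasFDerivAt f f' p₀) (hinj : Injective f')
    (hn : n ∉ LinearMap.range (f' : P →ₗ[ℝ] V)) (hdim : finrank ℝ P + 1 = finrank ℝ V) :
    ∃ Θ : OpenPartialHomeomorph (P × ℝ) V,
      (∀ q, Θ q = f q.1 + q.2 • n) ∧ (p₀, (0 : ℝ)) ∈ Θ.source := by
  -- the derivative as a continuous linear equivalence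
  have hdim' : finrank ℝ (P × ℝ) = finrank ℝ V := by
    rw [Module.finrank_prod, Module.finrank_self, hdim]
  set D : P × ℝ →L[ℝ] V :=
    f'.comp (ContinuousLinearMap.fst ℝ P ℝ) + (ContinuousLinearMap.snd ℝ P ℝ).smulRight n with hD
  set L : (P × ℝ) ≃L[ℝ] V :=
    (LinearMap.linearEquivOfInjective (D : P × ℝ →ₗ[ℝ] V)
      (injective_thickeningDeriv hinj hn) hdim').toContinuousLinearEquiv with hL
  have hLcoe : (L : P × ℝ →L[ℝ] V) = D :=
    ContinuousLinearMap.ext fun q => rfl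
  haveI : CompleteSpace (P × ℝ) := FiniteDimensional.complete ℝ (P × ℝ)
  set g : P × ℝ → V := fun q => f q.1 + q.2 • n with hg
  have hgc : ContDiffAt ℝ 1 g (p₀, 0) :=
    (hf.comp (p₀, (0 : ℝ)) contDiffAt_fst).add (contDiffAt_snd.smul contDiffAt_const)
  have hgd : HasFDerivAt g (L : P × ℝ →L[ℝ] V) (p₀, 0) := by
    rw [hLcoe]
    exact hasFDerivAt_thickening hf' n 0
  refine ⟨hgc.toOpenPartialHomeomorph g hgd one_ne_zero, fun q => rfl,
    hgc.mem_toOpenPartialHomeomorph_source hgd one_ne_zero⟩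

omit [NormedSpace ℝ P] in
/-- A neighbourhood of `(p₀, 0)` in `P × ℝ` contains a product `ball p₀ r × (-ε, ε)`.
[folklore] -/
theorem exists_ball_prod_Ioo_subset {p₀ : P} {s : Set (P × ℝ)} (hs : s ∈ 𝓝 (p₀, (0 : ℝ))) :
    ∃ r > 0, ∃ ε > 0, ball p₀ r ×ˢ Ioo (-ε) ε ⊆ s := by
  obtain ⟨δ, hδ, hball⟩ := Metric.mem_nhds_iff.1 hs
  refine ⟨δ, hδ, δ, hδ, fun q hq => hball ?_⟩
  rw [mem_ball, Prod.dist_eq, max_lt_iff]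
  refine ⟨hq.1, ?_⟩
  rw [Real.dist_eq, sub_zero, abs_lt]
  exact hq.2

end Thickening

/-! ### The two sides of a curved half-space in the thickening chart -/

section Sides

variable {P : Type*} [NormedAddCommGroup P] [NormedSpace ℝ P]

omit [NormedSpace ℝ P] in
/-- A vertical segment `{u} × [a, b]` is preconnected. [folklore] -/
theorem isPreconnected_singleton_prod_uIcc (u : P) (a b : ℝ) :
    IsPreconnected (({u} : Set P) ×ˢ uIcc a b) :=
  isPreconnected_singleton.prod isPreconnected_uIcc

/-- **The upper side is preconnected.**  For `B` convex and `|μ| < ε / 2` on `B`, the region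
`{(u, a) : u ∈ B, 0 < a < ε, μ u + a ≥ 0}` is preconnected: it contains the convex core
`B × (ε/2, ε)`, reached from every point by a vertical segment. [folklore] -/
theorem isPreconnected_upperSide {B : Set P} (hB : Convex ℝ B) {μ : P → ℝ} {ε : ℝ}
    (hμ : ∀ u ∈ B, |μ u| < ε / 2) :
    IsPreconnected {q : P × ℝ | q.1 ∈ B ∧ 0 < q.2 ∧ q.2 < ε ∧ 0 ≤ μ q.1 + q.2} := by
  set S := {q : P × ℝ | q.1 ∈ B ∧ 0 < q.2 ∧ q.2 < ε ∧ 0 ≤ μ q.1 + q.2} with hS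
  set C : Set (P × ℝ) := B ×ˢ Ioo (ε / 2) ε with hC
  have hCS : C ⊆ S := by
    rintro ⟨u, a⟩ ⟨hu, ha1, ha2⟩
    have := hμ u hu
    rw [abs_lt] at this
    refine ⟨hu, by linarith, ha2, by simp only; linarith⟩
  have hCc : IsPreconnected C := (hB.prod (convex_Ioo _ _)).isPreconnected
  refine isPreconnected_of_core hCc hCS fun x hx => ?_
  obtain ⟨hu, ha0, haε, hμa⟩ := hx
  -- the vertical segment from `x` up to height `max x.2 (3ε/4)`
  refine ⟨({x.1} : Set P) ×ˢ uIcc x.2 (max x.2 (3 * ε / 4)), ?_, ?_, ?_,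
    isPreconnected_singleton_prod_uIcc _ _ _⟩
  · rintro ⟨u, a⟩ ⟨hu', ha⟩
    simp only [mem_singleton_iff] at hu'
    subst hu'
    rw [uIcc_of_le (le_max_left _ _), mem_Icc] at ha
    have hε : 0 < ε := lt_trans ha0 haε
    refine ⟨hu, lt_of_lt_of_le ha0 ha.1, lt_of_le_of_lt ha.2 (max_lt haε (by linarith)), ?_⟩
    simp only at hμa ⊢
    linarith [ha.1]
  · exact ⟨rfl, left_mem_uIcc⟩
  · refine ⟨(x.1, max x.2 (3 * ε / 4)), ⟨rfl, right_mem_uIcc⟩, hu, ?_, ?_⟩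
    · have hε : 0 < ε := lt_trans ha0 haε
      exact lt_of_lt_of_le (by linarith) (le_max_right _ _)
    · have hε : 0 < ε := lt_trans ha0 haε
      exact max_lt haε (by linarith)

/-- **The upper side is preconnected** (general form: it suffices that `μ > -ε/2` on `B`, which
holds near any parameter with `μ ≥ 0` by continuity).  For `B` convex, the region
`{(u, a) : u ∈ B, 0 < a < ε, μ u + a ≥ 0}` is preconnected. [folklore] -/
theorem isPreconnected_upperSide_of_gt {B : Set P} (hB : Convex ℝ B) {μ : P → ℝ} {ε : ℝ}
    (hμ : ∀ u ∈ B, -(ε / 2) < μ u) :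
    IsPreconnected {q : P × ℝ | q.1 ∈ B ∧ 0 < q.2 ∧ q.2 < ε ∧ 0 ≤ μ q.1 + q.2} := by
  set S := {q : P × ℝ | q.1 ∈ B ∧ 0 < q.2 ∧ q.2 < ε ∧ 0 ≤ μ q.1 + q.2} with hS
  set C : Set (P × ℝ) := B ×ˢ Ioo (ε / 2) ε with hC
  have hCS : C ⊆ S := by
    rintro ⟨u, a⟩ ⟨hu, ha1, ha2⟩
    have := hμ u hu
    refine ⟨hu, by linarith, ha2, by simp only; linarith⟩
  have hCc : IsPreconnected C := (hB.prod (convex_Ioo _ _)).isPreconnected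
  refine isPreconnected_of_core hCc hCS fun x hx => ?_
  obtain ⟨hu, ha0, haε, hμa⟩ := hx
  refine ⟨({x.1} : Set P) ×ˢ uIcc x.2 (max x.2 (3 * ε / 4)), ?_, ?_, ?_,
    isPreconnected_singleton_prod_uIcc _ _ _⟩
  · rintro ⟨u, a⟩ ⟨hu', ha⟩
    simp only [mem_singleton_iff] at hu'
    subst hu'
    rw [uIcc_of_le (le_max_left _ _), mem_Icc] at ha
    have hε : 0 < ε := lt_trans ha0 haε
    refine ⟨hu, lt_of_lt_of_le ha0 ha.1, lt_of_le_of_lt ha.2 (max_lt haε (by linarith)), ?_⟩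
    simp only at hμa ⊢
    linarith [ha.1]
  · exact ⟨rfl, left_mem_uIcc⟩
  · refine ⟨(x.1, max x.2 (3 * ε / 4)), ⟨rfl, right_mem_uIcc⟩, hu, ?_, ?_⟩
    · have hε : 0 < ε := lt_trans ha0 haε
      exact lt_of_lt_of_le (by linarith) (le_max_right _ _)
    · have hε : 0 < ε := lt_trans ha0 haε
      exact max_lt haε (by linarith)

/-- **The lower side is preconnected.**  Let `B` be convex, `μ` continuous on `B`, `ℓ` a linear
functional with `μ > 0` where `ℓ > 0` and `μ ≤ 0` where `ℓ ≤ 0` (on `B`), and `ε > 0`.  Then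
the region `{(u, a) : u ∈ B, -ε < a < 0, μ u + a ≥ 0}` is preconnected: it lies over the
convex base `{ℓ > 0}`, contains the preconnected core `{(u, -t · min (μ u) (ε/2)) : 0 < t < 1}`,
and is reached from it by vertical segments. [folklore] -/
theorem isPreconnected_lowerSide {B : Set P} (hB : Convex ℝ B) {μ : P → ℝ}
    (hμc : ContinuousOn μ B) {ε : ℝ} (hε : 0 < ε) {ℓ : P →L[ℝ] ℝ}
    (hpos : ∀ u ∈ B, 0 < ℓ u → 0 < μ u) (hnonpos : ∀ u ∈ B, ℓ u ≤ 0 → μ u ≤ 0) :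
    IsPreconnected {q : P × ℝ | q.1 ∈ B ∧ q.2 < 0 ∧ -ε < q.2 ∧ 0 ≤ μ q.1 + q.2} := by
  set S := {q : P × ℝ | q.1 ∈ B ∧ q.2 < 0 ∧ -ε < q.2 ∧ 0 ≤ μ q.1 + q.2} with hS
  set Bp : Set P := B ∩ {u | 0 < ℓ u} with hBp
  have hBpc : Convex ℝ Bp := hB.inter (convex_halfSpace_gt ℓ.isLinear 0)
  set m : P → ℝ := fun u => min (μ u) (ε / 2) with hm
  have hmc : ContinuousOn m B := continuous_min.comp_continuousOn (hμc.prodMk continuousOn_const)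
  have hmpos : ∀ u ∈ Bp, 0 < m u := fun u hu => lt_min (hpos u hu.1 hu.2) (by linarith)
  have hmμ : ∀ u, m u ≤ μ u := fun u => min_le_left _ _
  have hmε : ∀ u, m u ≤ ε / 2 := fun u => min_le_right _ _
  -- the core
  set Φ : P × ℝ → P × ℝ := fun q => (q.1, -(q.2 * m q.1)) with hΦ
  set C : Set (P × ℝ) := Φ '' (Bp ×ˢ Ioo (0 : ℝ) 1) with hC
  have hΦc : ContinuousOn Φ (Bp ×ˢ Ioo (0 : ℝ) 1) := by
    refine continuousOn_fst.prodMk (ContinuousOn.neg (continuousOn_snd.mul ?_))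
    exact hmc.comp continuousOn_fst fun q hq => hq.1.1
  have hCc : IsPreconnected C :=
    ((hBpc.prod (convex_Ioo _ _)).isPreconnected).image Φ hΦc
  have hCS : C ⊆ S := by
    rintro _ ⟨⟨u, t⟩, ⟨hu, ht1, ht2⟩, rfl⟩
    have hm0 := hmpos u hu
    refine ⟨hu.1, ?_, ?_, ?_⟩
    · show -(t * m u) < 0
      nlinarith
    · show -ε < -(t * m u)
      nlinarith [hmε u]
    · show 0 ≤ μ u + -(t * m u)
      nlinarith [hmμ u]
  refine isPreconnected_of_core hCc hCS fun x hx => ?_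
  obtain ⟨hu, ha0, haε, hμa⟩ := hx
  have hℓ : 0 < ℓ x.1 := by
    by_contra h
    have := hnonpos x.1 hu (not_lt.1 h)
    linarith
  have hxB : x.1 ∈ Bp := ⟨hu, hℓ⟩
  have hm0 := hmpos x.1 hxB
  -- the vertical segment between `x.2` and `-(m x.1)/2`
  refine ⟨({x.1} : Set P) ×ˢ uIcc x.2 (-(m x.1) / 2), ?_, ⟨rfl, left_mem_uIcc⟩, ?_,
    isPreconnected_singleton_prod_uIcc _ _ _⟩
  · rintro ⟨u, a⟩ ⟨hu', ha⟩
    simp only [mem_singleton_iff] at hu'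
    subst hu'
    rcases mem_uIcc.1 ha with ha' | ha'
    · refine ⟨hu, by linarith [ha'.2], by linarith [ha'.1], ?_⟩
      simp only at hμa ⊢
      linarith [ha'.1]
    · refine ⟨hu, by linarith [ha'.2], ?_, ?_⟩
      · have := hmε x.1
        linarith [ha'.1]
      · simp only at hμa ⊢
        linarith [ha'.1, hmμ x.1]
  · refine ⟨(x.1, -(m x.1) / 2), ⟨rfl, right_mem_uIcc⟩, ⟨(x.1, 1 / 2), ⟨hxB, by norm_num, by norm_num⟩, ?_⟩⟩
    simp only [hΦ, Prod.mk.injEq, true_and]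
    ring

end Sides

end Literature.Analysis.Calculus
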